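import Literature.NumberTheory.LFunctions.BondarenkoHeap2026DiagonalProofs
import Literature.NumberTheory.LFunctions.ExceptionalPrimesSparse
import HarnessLib

/-!
# Bondarenko–Heap 2026, Proposition 3 (= Heath-Brown 1983, Lemma 3) DISCHARGED, and
# Proposition 5 with it

Topic `Literature/NumberTheory/LFunctions`, namespace
`Literature.NumberTheory.LFunctions.BondarenkoHeap2026`. LABEL (cell `rh-crit`, corpus C5 `ah`):
**NOT RH-BEARING** — a statement about primes `p ⩽ q^{500}` with `χ(p) = 1` GIVEN a real zero of
`L(s, χ)`; nothing here asserts that such zeros exist and nothing here bears on the truth of RH.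
Everything in this file is PROVED (theorems only; no definitions, no named facts):

* `prop3_holds : prop3` — the named fact `prop3` of `BondarenkoHeap2026Sections3to5.lean`
  ([BondarenkoHeap2026, Proposition 3, eq. (10), §3 p. 9; TeX l.449–460] = [Heathbrown1983,
  Lemma 3]: "Let `β = 1 − (𝓔 log q)^{−1}` be a real zero of `L(s, χ)`, with `𝓔 ⩾ 3`. Then
  `∑_{p ⩽ q^{500}, χ(p)=1} (log p)/p ≪ (log q)/√(log 𝓔)` where the implied constant is absolute")
  is now a THEOREM: it is `SiegelZero.HeathBrown1983_lemma3` (`ExceptionalPrimesSparse.lean`, the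
  elementary Tao–Teräväinen road through the tree's `ExceptionalPrimes*` files) read on the
  summation range `mimicryPrimes χ = {p ⩽ q^{500} : p prime, χ(p) = 1}`;
* `prop5_holds : prop5` — hence Proposition 5 (the diagonal `𝒟` of `J`, §5), previously proved
  from `prop3` (`prop5_of_prop3`, `BondarenkoHeap2026DiagonalProofs.lean`), holds outright;
* `theorem4_of_prop6` — and Theorem 4 is reduced to Proposition 6 alone
  (`theorem4_of_prop3_prop6`).

## References

* [BondarenkoHeap2026] A. Bondarenko, W. Heap, arXiv:2608.07399v1, §3 Proposition 3 (10),
  §5 Proposition 5, Theorem 4.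
* [Heathbrown1983] D. R. Heath-Brown, *Prime twins and Siegel zeros*, Proc. London Math. Soc. (3)
  47 (1983), Lemma 3.
* [TaoTeravainen2021] T. Tao, J. Teräväinen, J. London Math. Soc. (2) 106 (2022), §3.3 (3.20).
-/

noncomputable section

open Finset

namespace Literature.NumberTheory.LFunctions.BondarenkoHeap2026

/-- The summation range of (10) is the set of primes `p ⩽ q^{500}` with `χ(p) = 1`, i.e. Mathlib's
`Nat.primesLE (q^500)` filtered by `χ(p) = 1`. [cite: BondarenkoHeap2026, Proposition 3 (10)] -/
theorem mimicryPrimes_eq_filter {q : ℕ} (χ : DirichletCharacter ℂ q) :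
    mimicryPrimes χ = (Nat.primesLE (q ^ 500)).filter (fun p : ℕ => χ (p : ZMod q) = 1) := by
  classical
  ext p
  simp only [mem_mimicryPrimes, Finset.mem_filter, Nat.mem_primesLE]
  tauto

/-- **DISCHARGE of Proposition 3** ([BondarenkoHeap2026, Prop. 3 (10)] = [Heathbrown1983, Lemma 3]):
for `χ` primitive quadratic mod `q` and `𝓔 ⩾ 3` with `L(1 − 1/(𝓔 log q), χ) = 0`,
`∑_{p ⩽ q^{500}, χ(p) = 1} (log p)/p ⩽ C (log q)/√(log 𝓔)` with an absolute (ineffective) `C`.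
PROVED: `SiegelZero.HeathBrown1983_lemma3`. [cite: Heathbrown1983, Lemma 3] -/
theorem prop3_holds : prop3 := by
  obtain ⟨C, hC, H⟩ := SiegelZero.HeathBrown1983_lemma3
  refine ⟨C, hC, fun q _ χ hprim hquad E hE h0 => ?_⟩
  rw [mimicryPrimes_eq_filter]
  exact H q χ hprim hquad E hE h0

/-- **Proposition 5 holds outright** (the diagonal terms `𝒟`, [BondarenkoHeap2026, Prop. 5, §5
p. 13]): `prop5_of_prop3` fed with `prop3_holds`. [cite: BondarenkoHeap2026, Proposition 5] -/
theorem prop5_holds : prop5 :=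
  prop5_of_prop3 prop3_holds

/-- **Theorem 4 ⇐ Proposition 6 alone** ([BondarenkoHeap2026, Theorem 4, §2.3 p. 8]): with
Proposition 3 discharged, `theorem4_of_prop3_prop6` needs only the off-diagonal Proposition 6.
[cite: BondarenkoHeap2026, Theorem 4] -/
theorem theorem4_of_prop6 (h6 : prop6) : theorem4 :=
  theorem4_of_prop3_prop6 prop3_holds h6

end Literature.NumberTheory.LFunctions.BondarenkoHeap2026

end
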